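import Mathlib
import Literature.Analysis.ValidatedNumerics.PolySignCells
import Summits.Ventures.FusionMHD.Models.TearingFRS1EqSigmaM4N1
import HarnessLib

/-!
# F3.σ rider «#66‴ σ4» — certificate DATA 2/3: `posCells` chunk 2

Companion DATA of `Models/TearingFRS1EqSigmaM4.lean` (statement, model and provenance there; seat `gridfusion-sos-6` g4; generator
`HOME/cert/sos-6/sigma/{ratcert_eq.py, emit_rat_eq.py, split_eq4b.py}`).  The 90-cell `posCells` cover of the degree-68 cleared polynomial `N`
(σ = 1/10000, force-balanced FRS1 model) is split in three kernel checks of 30 cells, one per file (lead 11:20Z: «cells ≲ 50 per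
decide at cleared degree ≲ 60»; measured: 45 cells × 90-digit integers exceed one decide's budget).  SIGN FACTS ONLY; nothing here is a
stability statement.  [instance data]
-/

noncomputable section

open Set
open Literature.Analysis.ValidatedNumerics.ExpPoly

namespace Summit.Ventures.FusionMHD.Models

namespace TearingFRS1

namespace EqSigmaR5

/-- Breakpoints of chunk 2 of the `posCells` cover: cells of `[327/512, 87/128]` (30 cells). [instance data] -/
def mid2Eq4 : List ℚ := [((41 : ℚ) / 64), ((329 : ℚ) / 512), ((165 : ℚ) / 256), ((331 : ℚ) / 512), ((663 : ℚ) / 1024), ((83 : ℚ) / 128), ((665 : ℚ) / 1024), ((333 : ℚ) / 512), ((667 : ℚ) / 1024), ((167 : ℚ) / 256), ((669 : ℚ) / 1024), ((1339 : ℚ) / 2048), ((335 : ℚ) / 512), ((671 : ℚ) / 1024), ((21 : ℚ) / 32), ((673 : ℚ) / 1024), ((337 : ℚ) / 512), ((675 : ℚ) / 1024), ((169 : ℚ) / 256), ((677 : ℚ) / 1024), ((339 : ℚ) / 512), ((85 : ℚ) / 128), ((341 : ℚ) / 512), ((171 : ℚ) / 256), ((343 : ℚ) / 512), ((43 : ℚ)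 / 64), ((345 : ℚ) / 512), ((173 : ℚ) / 256), ((347 : ℚ) / 512)]

set_option maxRecDepth 100000 in
/-- Kernel check `N > 0` on the cells of `[327/512, 87/128]`. [instance data] -/
theorem NEq4_posCells2 : Poly.posCells NEq4 (((327 : ℚ) / 512) :: (mid2Eq4 ++ [((87 : ℚ) / 128)])) = true := by
  decide +kernel

end EqSigmaR5

end TearingFRS1

end Summit.Ventures.FusionMHD.Models

end
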